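import Summits.NavierStokesRegularity.NavierStokesRegularity.Theses.PalasekTowerBreakdown
import Summits.NavierStokesRegularity.FluidComputer.PalasekTowerRegisterGlobalFloorsAt

/-!
# NavierStokesRegularity — route `PalasekTowerBreakdown`, item `HeredityAtOne`: the lower stub in its three floors, by name

Supports `stmt-NavierStokesRegularity-19249` (`HeredityAtOne`, the hand-over `1 → 2`; it does NOT close
it and nobody claims it here). Cell `ns-blowup`, seat `ns-palasek-19249-p2` (D-0081 §C stub-worker on the
registered birth line v2 b90ab6bc703b9c77, stub `stub_readout_floors_one : ReadoutFloorsAt 1`; the holder of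
record ecbridge-1 g6 keeps the lead and the upper stub `AprioriCeilingAt 1`). LABEL: E–C typing (pure glue
over the landed register file `FluidComputer/PalasekTowerRegisterGlobalFloorsAt.lean`, by name on the route
decls). WHAT THIS IS NOT: not NS — no stage, tower or instance is constructed; the item, its halves and the
three floors are OPEN and appear only inside equivalences / implications.

* `palasekTowerBreakdown_heredityAtOne_iff_apriori_speed_strain_core :
  PalasekTowerBreakdown.HeredityAtOne ↔ AprioriCeilingAt 1 ∧ SpeedFloorAt 1 ∧ StrainFloorAt 1 ∧ CoreFloorAt 1`
  — the item in FOUR physics conjuncts, no hypothesis: «no overshoot of `(5/3)·Y₂` before `τ₂`» ∧ «speed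
  `≥ Y₂` in the ball at `τ₂`» ∧ «strain `≥ A₂` in the ball at `τ₂`» ∧ «an `N₂`-core at `τ₂`», each asked
  of EVERY finite-energy classical continuation inside the ceiling of EVERY registered level-1 stage of
  every pinned (`Λ = 8`, `θ = 6/5`) rigid quiet wide design; the composition and the projections;
* `palasekTowerBreakdown_readoutFloorsAt_one_iff_floors` — the registered lower stub is LOSSLESSLY the
  conjunction `SpeedFloorAt 1 ∧ StrainFloorAt 1 ∧ CoreFloorAt 1` (the sub-line `readout_floors_one`);
* `palasekTowerBreakdown_heredityAtOne_speed_jump` — what the speed conjunct alone says by name: under the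
  item, every tame continuation of a registered level-1 stage `s` has a point of the ball whose speed at
  `τ₂` STRICTLY exceeds `s`'s speed everywhere at `τ₁` (`(5/3)·Y₁ < Y₂`, certified): the floor is a jump
  made inside `(τ₁, τ₂]`, never inherited;
* the sibling and the parent in the same currency:
  `palasekTowerBreakdown_heredityFromTwo_iff_forall_apriori_floors3`,
  `palasekTowerBreakdown_episodeInduction_iff_forall_apriori_floors3`.

References: S. Palasek, arXiv:2605.13827 §4 [cite: Palasek2026ElementaryModel, §4]; H. Sohr, *The
Navier–Stokes Equations*, Birkhäuser 2001, Ch. V Thm. 1.5.1 [cite: Sohr2001, Ch. V Thm. 1.5.1].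
-/

-- `Summit.<Summit>.<Problem>` is the tree's mandated summit-side namespace (CONVENTIONS §2); for this
-- single-conjunct summit the two coincide, so the duplicate is deliberate.
set_option linter.dupNamespace false

namespace Summit.NavierStokesRegularity.NavierStokesRegularity.Theorems

open Set MeasureTheory
open scoped ENNReal ContDiff
open Literature.Analysis.FluidPDE
open Summit.NavierStokesRegularity.NavierStokesRegularity.Theses
open Summit.NavierStokesRegularity.FluidComputer.PalasekTowerClayBridge

/-- **Item `HeredityAtOne` ⇔ its four physics conjuncts — no hypothesis**:
`PalasekTowerBreakdown.HeredityAtOne ↔ AprioriCeilingAt 1 ∧ SpeedFloorAt 1 ∧ StrainFloorAt 1 ∧ CoreFloorAt 1`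
(route decl by name; body `heredityAtOne_iff_apriori_speed_strain_core`). [cite: Palasek2026ElementaryModel, §4] -/
theorem palasekTowerBreakdown_heredityAtOne_iff_apriori_speed_strain_core :
    PalasekTowerBreakdown.HeredityAtOne ↔
      AprioriCeilingAt 1 ∧ SpeedFloorAt 1 ∧ StrainFloorAt 1 ∧ CoreFloorAt 1 := by
  unfold PalasekTowerBreakdown.HeredityAtOne
  exact heredityAtOne_iff_apriori_speed_strain_core

/-- **The composition the refined line registers**: no overshoot + the three level-2 floors ⇒
`PalasekTowerBreakdown.HeredityAtOne`. [cite: Palasek2026ElementaryModel, §4] -/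
theorem palasekTowerBreakdown_heredityAtOne_of_apriori_speed_strain_core (hA : AprioriCeilingAt 1)
    (h₁ : SpeedFloorAt 1) (h₂ : StrainFloorAt 1) (h₃ : CoreFloorAt 1) :
    PalasekTowerBreakdown.HeredityAtOne :=
  palasekTowerBreakdown_heredityAtOne_iff_apriori_speed_strain_core.2 ⟨hA, h₁, h₂, h₃⟩

/-- The item yields the level-2 speed floor (no W14). [cite: Sohr2001, Ch. V Thm. 1.5.1] -/
theorem palasekTowerBreakdown_heredityAtOne_speedFloorAt (h : PalasekTowerBreakdown.HeredityAtOne) :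
    SpeedFloorAt 1 :=
  (palasekTowerBreakdown_heredityAtOne_iff_apriori_speed_strain_core.1 h).2.1

/-- The item yields the level-2 strain floor (no W14). [cite: Sohr2001, Ch. V Thm. 1.5.1] -/
theorem palasekTowerBreakdown_heredityAtOne_strainFloorAt (h : PalasekTowerBreakdown.HeredityAtOne) :
    StrainFloorAt 1 :=
  (palasekTowerBreakdown_heredityAtOne_iff_apriori_speed_strain_core.1 h).2.2.1

/-- The item yields the level-2 core floor (no W14). [cite: Sohr2001, Ch. V Thm. 1.5.1] -/
theorem palasekTowerBreakdown_heredityAtOne_coreFloorAt (h : PalasekTowerBreakdown.HeredityAtOne) :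
    CoreFloorAt 1 :=
  (palasekTowerBreakdown_heredityAtOne_iff_apriori_speed_strain_core.1 h).2.2.2

/-- **The registered lower stub in its three floors, losslessly**:
`ReadoutFloorsAt 1 ↔ SpeedFloorAt 1 ∧ StrainFloorAt 1 ∧ CoreFloorAt 1` (the sub-line `readout_floors_one` of
the birth line on item 19249). [folklore] -/
theorem palasekTowerBreakdown_readoutFloorsAt_one_iff_floors :
    ReadoutFloorsAt 1 ↔ SpeedFloorAt 1 ∧ StrainFloorAt 1 ∧ CoreFloorAt 1 :=
  readoutFloorsAt_iff_floors

/-- **The speed conjunct is a jump, by name.** Under `PalasekTowerBreakdown.HeredityAtOne`, for every pinned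
rigid quiet wide schedule, every registered level-1 stage `s` and every finite-energy classical continuation
`(u, p)` of `s` to `τ₂` inside `(5/3)·Y₂`, some point `x` of the ball has `‖s.u(τ₁, y)‖ < ‖u(τ₂, x)‖` for
ALL `y ∈ ℝ³` (`‖s.u(τ₁, ·)‖ ≤ (5/3)·Y₁ < Y₂ ≤ ‖u(τ₂, x)‖`). [cite: Palasek2026ElementaryModel, §4] -/
theorem palasekTowerBreakdown_heredityAtOne_speed_jump (h : PalasekTowerBreakdown.HeredityAtOne) :
    ∀ S : Schedule TowerRates.wide, S.Pins 8 (6 / 5) → S.Rigid → S.Quiet →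
      ∀ s : Stage 1 TowerRates.wide S (Margins.routeG TowerRates.wide) 1,
      ∀ (u : ℝ → EuclideanSpace ℝ (Fin 3) → EuclideanSpace ℝ (Fin 3))
        (p : ℝ → EuclideanSpace ℝ (Fin 3) → ℝ),
        IsClassicalNSSolutionOn (Icc 0 (S.τ 2)) 1 S.f u p →
        (∀ t ∈ Icc 0 (S.τ 1), u t = s.u t ∧ p t = s.p t) →
        (∃ C : ℝ≥0∞, C < ⊤ ∧ ∀ t ∈ Icc 0 (S.τ 2), ∫⁻ x, ‖u t x‖ₑ ^ 2 ≤ C) →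
        (∀ t ∈ Icc 0 (S.τ 2), ∀ x, ‖u t x‖ ≤ S.c₂ * TowerRates.wide.Y 2) →
        ∃ x, ‖x‖ ≤ S.radius ∧ ∀ y, ‖s.u (S.τ 1) y‖ < ‖u (S.τ 2) x‖ :=
  (palasekTowerBreakdown_heredityAtOne_speedFloorAt h).exists_exceeds_stage_one

/-- **The sibling `HeredityFromTwo` in the same currency — no hypothesis**:
`PalasekTowerBreakdown.HeredityFromTwo ↔ ∀ k ≥ 2, AprioriCeilingAt k ∧ SpeedFloorAt k ∧ StrainFloorAt k ∧ CoreFloorAt k`.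
[cite: Palasek2026ElementaryModel, §4] -/
theorem palasekTowerBreakdown_heredityFromTwo_iff_forall_apriori_floors3 :
    PalasekTowerBreakdown.HeredityFromTwo ↔
      ∀ k : ℕ, 2 ≤ k → AprioriCeilingAt k ∧ SpeedFloorAt k ∧ StrainFloorAt k ∧ CoreFloorAt k := by
  unfold PalasekTowerBreakdown.HeredityFromTwo
  rw [heredityFrom_iff_forall_apriori_and_floors (by norm_num : 1 ≤ 2)]
  refine forall_congr' fun k => forall_congr' fun _ => ?_
  rw [readoutFloorsAt_iff_floors]

/-- **The parent `EpisodeInduction` (= K2G) in the same currency — no hypothesis**: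
`PalasekTowerBreakdown.EpisodeInduction ↔ ∀ k ≥ 1, AprioriCeilingAt k ∧ SpeedFloorAt k ∧ StrainFloorAt k ∧ CoreFloorAt k`
— the crux of the route is, level by level, «no overshoot» and the three floors of the next level; every
existence / continuation / uniqueness question is settled by theorem. [cite: Palasek2026ElementaryModel, §4] -/
theorem palasekTowerBreakdown_episodeInduction_iff_forall_apriori_floors3 :
    PalasekTowerBreakdown.EpisodeInduction ↔
      ∀ k : ℕ, 1 ≤ k → AprioriCeilingAt k ∧ SpeedFloorAt k ∧ StrainFloorAt k ∧ CoreFloorAt k := by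
  unfold PalasekTowerBreakdown.EpisodeInduction
  rw [episodeInductionG_iff_forall_apriori_and_floors]
  refine forall_congr' fun k => forall_congr' fun _ => ?_
  rw [readoutFloorsAt_iff_floors]

/-! ## §6 (appended, v2 — ns-palasek-19249-p2 g2, 2026-08-26) Each registered stub of line `birth` v3 is DECIDED BY THE BASE

The four registered stubs `AprioriCeilingAt 1`, `SpeedFloorAt 1`, `StrainFloorAt 1`, `CoreFloorAt 1` share the quantifier
prefix «for every pinned (`Λ = 8`, `θ = 6/5`), rigid, quiet wide schedule and EVERY registered level-1 stage …», and the
route's base item `PalasekTowerBreakdown.EpisodeBase` (= `EpisodeBaseG`) is exactly «some such schedule carries a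
registered level-1 stage». Consequences, by name on the route decls and per conjunct (the item-level dichotomy
`heredityAtOne_or_episodeBaseG` is ecbridge's; the level-`≥ 2` analogue `palasekTowerBreakdown_floors3_of_not_rungG_two`
is ns-palasek-19250-p1's):

* `palasekTowerBreakdown_readoutAt_one_of_not_episodeBase` — `¬ EpisodeBase → ReadoutAt 1 P` for EVERY predicate `P`
  (so for the three floors), and `palasekTowerBreakdown_aprioriCeilingAt_one_of_not_episodeBase`;
  `palasekTowerBreakdown_stubs_of_not_episodeBase` — `¬ EpisodeBase → AprioriCeilingAt 1 ∧ SpeedFloorAt 1 ∧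
  StrainFloorAt 1 ∧ CoreFloorAt 1` (hence the item, `…_heredityAtOne_of_not_episodeBase`);
* conversely `palasekTowerBreakdown_episodeBase_of_not_speedFloorAt_one` / `…strainFloorAt_one` / `…coreFloorAt_one` /
  `…aprioriCeilingAt_one` — a refutation of ANY ONE registered stub inhabits the base item (its counterexample begins
  with a registered level-1 stage); and the four dichotomies `<stub> ∨ EpisodeBase`;
* `palasekTowerBreakdown_not_speedFloorAt_one_iff` — the refutation SHAPE of the speed stub, symbol by symbol: `¬ SpeedFloorAt 1`
  iff some pinned rigid quiet wide schedule carries a registered level-1 stage AND a finite-energy classical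
  continuation of it to `τ₂` inside `(5/3)·Y₂` whose speed at `τ₂` is `< c₁·Y₂` at every point of the ball — a level-1
  DESIGN (item 19179's open content) together with ONE tame run; nothing less is a counterexample, nothing more is needed.

Reading (record only, no item moves): none of the four stubs can be refuted before item 19179 is PROVED with an exhibited
stage, and `¬ EpisodeBase` proves all four at once; a proof of a stub that does not pass through `¬ EpisodeBase` is a
universal amplification statement about the free unit-viscosity flow from registered level-1 slices
(`readoutAt_iff_sliceRun`, `aprioriCeilingAt_one_iff_freeRunCeiling`). WHAT THIS IS NOT: not NS — classical logic over
the typed register; nothing is constructed, no stub is proved or refuted. -/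

/-- **Emptiness of the level-1 register gives every level-1 readout schema** (vacuously): for every predicate `P`,
`¬ PalasekTowerBreakdown.EpisodeBase → ReadoutAt 1 P`. [folklore] -/
theorem palasekTowerBreakdown_readoutAt_one_of_not_episodeBase
    {P : Schedule TowerRates.wide → (EuclideanSpace ℝ (Fin 3) → EuclideanSpace ℝ (Fin 3)) → Prop}
    (hN : ¬ PalasekTowerBreakdown.EpisodeBase) : ReadoutAt 1 P := by
  intro S hP hR hQ s
  exact (hN ⟨S, hP, hR, hQ, ⟨s⟩⟩).elim

/-- Emptiness of the level-1 register gives the upper stub `AprioriCeilingAt 1` (vacuously). [folklore] -/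
theorem palasekTowerBreakdown_aprioriCeilingAt_one_of_not_episodeBase
    (hN : ¬ PalasekTowerBreakdown.EpisodeBase) : AprioriCeilingAt 1 := by
  intro S hP hR hQ s
  exact (hN ⟨S, hP, hR, hQ, ⟨s⟩⟩).elim

/-- **`¬ EpisodeBase` proves all four registered stubs of line `birth` v3 at once** (vacuous branch, per
conjunct). [folklore] -/
theorem palasekTowerBreakdown_stubs_of_not_episodeBase (hN : ¬ PalasekTowerBreakdown.EpisodeBase) :
    AprioriCeilingAt 1 ∧ SpeedFloorAt 1 ∧ StrainFloorAt 1 ∧ CoreFloorAt 1 :=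
  ⟨palasekTowerBreakdown_aprioriCeilingAt_one_of_not_episodeBase hN,
    palasekTowerBreakdown_readoutAt_one_of_not_episodeBase hN,
    palasekTowerBreakdown_readoutAt_one_of_not_episodeBase hN,
    palasekTowerBreakdown_readoutAt_one_of_not_episodeBase hN⟩

/-- … hence the item itself (the route-killing branch `¬ EpisodeBase → HeredityAtOne`, by name on both route
decls; ecbridge's `heredityAtOne_or_episodeBaseG` in the route's vocabulary). [folklore] -/
theorem palasekTowerBreakdown_heredityAtOne_of_not_episodeBase (hN : ¬ PalasekTowerBreakdown.EpisodeBase) :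
    PalasekTowerBreakdown.HeredityAtOne :=
  have h := palasekTowerBreakdown_stubs_of_not_episodeBase hN
  palasekTowerBreakdown_heredityAtOne_of_apriori_speed_strain_core h.1 h.2.1 h.2.2.1 h.2.2.2

/-- **A refutation of a level-1 readout schema inhabits the base item**: `¬ ReadoutAt 1 P → EpisodeBase`.
[folklore] -/
theorem palasekTowerBreakdown_episodeBase_of_not_readoutAt_one
    {P : Schedule TowerRates.wide → (EuclideanSpace ℝ (Fin 3) → EuclideanSpace ℝ (Fin 3)) → Prop}
    (h : ¬ ReadoutAt 1 P) : PalasekTowerBreakdown.EpisodeBase := by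
  by_contra hN
  exact h (palasekTowerBreakdown_readoutAt_one_of_not_episodeBase hN)

/-- A refutation of the registered stub `SpeedFloorAt 1` proves item 19179 `EpisodeBase`. [folklore] -/
theorem palasekTowerBreakdown_episodeBase_of_not_speedFloorAt_one (h : ¬ SpeedFloorAt 1) :
    PalasekTowerBreakdown.EpisodeBase :=
  palasekTowerBreakdown_episodeBase_of_not_readoutAt_one h

/-- A refutation of the registered stub `StrainFloorAt 1` proves item 19179 `EpisodeBase`. [folklore] -/
theorem palasekTowerBreakdown_episodeBase_of_not_strainFloorAt_one (h : ¬ StrainFloorAt 1) :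
    PalasekTowerBreakdown.EpisodeBase :=
  palasekTowerBreakdown_episodeBase_of_not_readoutAt_one h

/-- A refutation of the registered stub `CoreFloorAt 1` proves item 19179 `EpisodeBase`. [folklore] -/
theorem palasekTowerBreakdown_episodeBase_of_not_coreFloorAt_one (h : ¬ CoreFloorAt 1) :
    PalasekTowerBreakdown.EpisodeBase :=
  palasekTowerBreakdown_episodeBase_of_not_readoutAt_one h

/-- A refutation of the registered upper stub `AprioriCeilingAt 1` proves item 19179 `EpisodeBase`. [folklore] -/
theorem palasekTowerBreakdown_episodeBase_of_not_aprioriCeilingAt_one (h : ¬ AprioriCeilingAt 1) :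
    PalasekTowerBreakdown.EpisodeBase := by
  by_contra hN
  exact h (palasekTowerBreakdown_aprioriCeilingAt_one_of_not_episodeBase hN)

/-- Dichotomy for the speed stub: `SpeedFloorAt 1 ∨ EpisodeBase`. [folklore] -/
theorem palasekTowerBreakdown_speedFloorAt_one_or_episodeBase :
    SpeedFloorAt 1 ∨ PalasekTowerBreakdown.EpisodeBase :=
  (em (SpeedFloorAt 1)).imp_right palasekTowerBreakdown_episodeBase_of_not_speedFloorAt_one

/-- Dichotomy for the strain stub: `StrainFloorAt 1 ∨ EpisodeBase`. [folklore] -/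
theorem palasekTowerBreakdown_strainFloorAt_one_or_episodeBase :
    StrainFloorAt 1 ∨ PalasekTowerBreakdown.EpisodeBase :=
  (em (StrainFloorAt 1)).imp_right palasekTowerBreakdown_episodeBase_of_not_strainFloorAt_one

/-- Dichotomy for the core stub: `CoreFloorAt 1 ∨ EpisodeBase`. [folklore] -/
theorem palasekTowerBreakdown_coreFloorAt_one_or_episodeBase :
    CoreFloorAt 1 ∨ PalasekTowerBreakdown.EpisodeBase :=
  (em (CoreFloorAt 1)).imp_right palasekTowerBreakdown_episodeBase_of_not_coreFloorAt_one

/-- Dichotomy for the upper stub: `AprioriCeilingAt 1 ∨ EpisodeBase`. [folklore] -/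
theorem palasekTowerBreakdown_aprioriCeilingAt_one_or_episodeBase :
    AprioriCeilingAt 1 ∨ PalasekTowerBreakdown.EpisodeBase :=
  (em (AprioriCeilingAt 1)).imp_right palasekTowerBreakdown_episodeBase_of_not_aprioriCeilingAt_one

/-- **The refutation shape of the speed stub, symbol by symbol.** `¬ SpeedFloorAt 1` holds iff some pinned
(`Λ = 8`, `θ = 6/5`), rigid, quiet wide schedule carries a registered level-1 stage `s` AND a classical solution
`(u, p)` of the design's system on `[0, τ₂]` agreeing with `s` on `[0, τ₁]`, of finite energy, inside `c₂·Y₂` on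
`[0, τ₂] × ℝ³`, whose speed at `τ₂` is `< c₁·Y₂` at every point of the ball `‖x‖ ≤ radius`. The first four
components are a witness of `EpisodeBase` with a tame run to `τ₂`; the last is the lazy readout. [folklore] -/
theorem palasekTowerBreakdown_not_speedFloorAt_one_iff :
    ¬ SpeedFloorAt 1 ↔
      ∃ (S : Schedule TowerRates.wide) (_ : S.Pins 8 (6 / 5)) (_ : S.Rigid) (_ : S.Quiet)
        (s : Stage 1 TowerRates.wide S (Margins.routeG TowerRates.wide) 1)
        (u : ℝ → EuclideanSpace ℝ (Fin 3) → EuclideanSpace ℝ (Fin 3))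
        (p : ℝ → EuclideanSpace ℝ (Fin 3) → ℝ),
        IsClassicalNSSolutionOn (Icc 0 (S.τ 2)) 1 S.f u p ∧
        (∀ t ∈ Icc 0 (S.τ 1), u t = s.u t ∧ p t = s.p t) ∧
        (∃ C : ℝ≥0∞, C < ⊤ ∧ ∀ t ∈ Icc 0 (S.τ 2), ∫⁻ x, ‖u t x‖ₑ ^ 2 ≤ C) ∧
        (∀ t ∈ Icc 0 (S.τ 2), ∀ x, ‖u t x‖ ≤ S.c₂ * TowerRates.wide.Y 2) ∧
        ∀ x, ‖x‖ ≤ S.radius → ‖u (S.τ 2) x‖ < S.c₁ * TowerRates.wide.Y 2 := by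
  constructor
  · intro h
    by_contra hne
    apply h
    intro S hP hR hQ s u p hcl hagree hE hceil
    by_contra hno
    push Not at hno
    exact hne ⟨S, hP, hR, hQ, s, u, p, hcl, hagree, hE, hceil, fun x hx => hno x hx⟩
  · rintro ⟨S, hP, hR, hQ, s, u, p, hcl, hagree, hE, hceil, hslow⟩ h
    obtain ⟨x, hx, hfl⟩ := h S hP hR hQ s u p hcl hagree hE hceil
    exact absurd (hslow x hx) (not_lt.2 hfl)

end Summit.NavierStokesRegularity.NavierStokesRegularity.Theorems
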